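import Summits.QuantumFields.YangMills.Theorems.BalabanUVNodesN15VectorPieceSiteRel
import Literature.MathematicalPhysics.QuantumFieldTheory.Balaban1983to89.B9Eq3130MatrixLetters
import HarnessLib

/-!
# Route «BalabanUVNodes» (K4 «SpineRates»), node N15 = NE2 — A2 NON-VACUITY CERTIFICATE FOR THE RELATIVE-FORM FACES: the NE2⁰-type `U ≡ 1` data `SiteRelDatum`,
# `UnitRelDatum` are SATISFIABLE (identity forms, `M₀ = 0`), hence `n15At_vectorPiece_vWordsExpC_of_rel` is not a vacuous implication

Cell `pub-ymgap`, seat `pub-ymgap-dag-n15-c` (generation g5; R134 ACCELERATION SEAT, strategy s1; HUMAN RULING D-0062; chair R424 venue; `bears_on: R4∕N15`).  Filed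
`--supports stmt-QuantumFields-20292 --as helper` (K3⁗; count-neutral).  Imports this seat's R3s `…N15VectorPieceSiteRel` and [B6]'s `B9Eq3130MatrixLetters` (`hasMaj_id_ofBlocks`) BY NAME; nothing in the tree is modified.

WHAT THIS FILE IS.  `siteRelDatum_id`, `unitRelDatum_id`: the abstract `U ≡ 1` forms `Ks = Ks′ = 1`, `Ku = Ku′ = 1` with inverses `W = 1` (majorant `1·e^{−δd}` by [B6]
`hasMaj_id_ofBlocks`, `d(y,y) = 0`) and η-defect `𝔇(1, 1) = 0` (letter with `M₀ = 0`) inhabit `SiteRelDatum` ∕ `UnitRelDatum` for every `δ > 0`; ★ `n15At_vectorPiece_vWordsExpC_idForms`: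
the face R3s `n15At_vectorPiece_vWordsExpC_of_rel` at these data — `YMDAG.UVSplit.N15At` for the carrier record whose site ∕ unit kernels are the η-differences of the inverses of
`1 + P_site(A′)` ∕ `1 + P_unit(A′)` (the piece's dressing words around the IDENTITY), with NO hypothesis beyond `d + 1 ≥ 2`, `L ≥ 2`, `c₃₅ > 0`.

HONEST FRAMING ∕ LIMITS — READ THIS.  (1) This is an A2 (non-vacuity) certificate for the HYPOTHESES of the `_rel` faces, nothing more: the identity is NOT Bałaban's `U ≡ 1` site
operator `QG²Q*` nor King's unit form `Δ^{(k)}`; the physically meaningful instantiation is NOT made here.  (2) It also says plainly what the referees' D1∕A-checks already encode: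
`N15At` evaluated at a SELF-CHOSEN carrier record is a weak statement — `B9.SiteKernel` is a bare kernel, so even the zero kernel inhabits `NE2PlusSite`∕`NE2PlusUnit`; an
unconditional inhabitant therefore discharges NOTHING of N15 (the count moves only through `S_N15 RRec` at the record's ACTUAL reading).  (3) What the certificate does show
is that the `_rel` theorems' η-rate mechanism (exact inverse rule + Leibniz on the dressing words + Neumann series below the two thresholds) runs on honest, non-empty data.
NE2⁺ NOT PRINTED, NOT proved for Bałaban's objects; count-neutral (typed 28∕28; discharged count unchanged); N15 NOT discharged; one finite T⁴ at fixed ε — NOT ℝ⁴, NOT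
infinite volume, NOT OS, NOT a mass gap, NOT Clay.
-/

noncomputable section

namespace Summit.QuantumFields.YangMills.BalabanUVNodes.N15.VectorPiece

open Literature.MathematicalPhysics.QuantumFieldTheory.Balaban1983to89
open Literature.MathematicalPhysics.QuantumFieldTheory.Balaban1983to89.B11SectG (BlockNorm HasMaj hasMaj_zero)
open Literature.MathematicalPhysics.QuantumFieldTheory.Balaban1983to89.T4EtaRateDefect (idef)
open Literature.MathematicalPhysics.QuantumFieldTheory.Balaban1983to89.B5Prop11Plancherel (Tor fine)
open Literature.MathematicalPhysics.QuantumFieldTheory.Balaban1983to89.B9Eq3130MatrixLetters (hasMaj_id_ofBlocks)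
open Literature.MathematicalPhysics.QuantumFieldTheory.King1986.Torus (tdistT_self)
open Summit.QuantumFields.YangMills.BalabanUVNodes.N15.MatrixSpecies (liftBlk)
open YMDAG.UVSplit (N15At)

variable {d : ℕ} {𝔄 : Type} [NormedRing 𝔄] [NormedAlgebra ℝ 𝔄] [CompleteSpace 𝔄] {ι : Type} [Fintype ι] [DecidableEq ι] (e : 𝔄 ≃L[ℝ] (ι → ℝ)) {L : ℕ} [NeZero L]
  (a : ℝ)

/-- The η-defect of the identity against itself (identity transports) vanishes: `𝔇(1, 1) = 1∘1 − 1∘1 = 0`. [folklore] -/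
theorem idef_id_id {F : Type} [AddCommGroup F] [Module ℝ F] :
    idef (LinearMap.id : F →ₗ[ℝ] F) LinearMap.id LinearMap.id LinearMap.id = 0 := sub_self _

omit [DecidableEq ι] [NeZero L] in
/-- **IDENTITY FORMS INHABIT `SiteRelDatum`** (`β_W = 1`, any `δ_W > 0`, `M₀ = 0`). [folklore] -/
theorem siteRelDatum_id {δW : ℝ} (hδW : 0 < δW) :
    SiteRelDatum (d := d) (ι := ι) (L := L) (fun _ => LinearMap.id) (fun _ => LinearMap.id) (fun _ => LinearMap.id) (fun _ => LinearMap.id) 1 δW 0 := by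
  refine ⟨zero_le_one, hδW, le_rfl, fun j => ?_, fun j => ?_, fun _ => LinearMap.comp_id _, fun _ => LinearMap.comp_id _, fun j => ?_⟩
  · exact hasMaj_id_ofBlocks (g := unitTorusGeoS L j.k j.Mn j.Msz) (liftBlk (fun b : Tor j.Mn × Fin (d + 1) => b.1) ι) (fun y => tdistT_self j.Mn y) δW
  · exact hasMaj_id_ofBlocks (g := unitTorusGeoS L j.k j.Mn j.Msz) (liftBlk (fun b : Tor j.Mn × Fin (d + 1) => b.1) ι) (fun y => tdistT_self j.Mn y) δW
  · rw [idef_id_id]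
    exact (hasMaj_zero _ _).mono fun y y' => by simp

omit [DecidableEq ι] [NeZero L] in
/-- **IDENTITY FORMS INHABIT `UnitRelDatum`** (`β_W = 1`, any `δ_W > 0`, `M₀ = 0`). [folklore] -/
theorem unitRelDatum_id {δW : ℝ} (hδW : 0 < δW) :
    UnitRelDatum (d := d) (ι := ι) (L := L) (fun _ => LinearMap.id) (fun _ => LinearMap.id) (fun _ => LinearMap.id) (fun _ => LinearMap.id) 1 δW 0 := by
  refine ⟨zero_le_one, hδW, le_rfl, fun j => ?_, fun j => ?_, fun _ => LinearMap.comp_id _, fun _ => LinearMap.comp_id _, fun j => ?_⟩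
  · exact hasMaj_id_ofBlocks (g := unitTorusGeoS L j.k j.Mn j.Msz) (liftBlk (fun b : Tor j.Mn × Fin (d + 1) => b.1) ι) (fun y => tdistT_self j.Mn y) δW
  · exact hasMaj_id_ofBlocks (g := unitTorusGeoS L j.k j.Mn j.Msz) (liftBlk (fun b : Tor j.Mn × Fin (d + 1) => b.1) ι) (fun y => tdistT_self j.Mn y) δW
  · rw [idef_id_id]
    exact (hasMaj_zero _ _).mono fun y y' => by simp

/-- ★ **THE RELATIVE-FORM FACE IS NOT VACUOUS**: `N15At` — all three conjuncts by name — for the carrier record of R3s at the IDENTITY `U ≡ 1` forms on both layers, with no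
hypothesis beyond `d + 1 ≥ 2`, `L ≥ 2`, `c₃₅ > 0` (A2 certificate; see the module docstring for what this does NOT mean). [bookkeeping] -/
theorem n15At_vectorPiece_vWordsExpC_idForms (hd : 1 ≤ d) (hL : 1 ≤ L) (hL2 : 2 ≤ L) {c35 : ℝ} (hc35 : 0 < c35) (p : ℝ) :
    N15At { I := VecIndexS d L, c35 := c35, p := p, pi := v1GVecInstance (d := d) 𝔄 ι L hL,
            Kop := vWGCVecFamily4 (d := d) 𝔄 ι e L a hL (expFc ι e L) (expFsc ι e L) (expFf ι e L) (expFsf ι e L),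
            Ksite := vWGCVecSiteRelKernel (d := d) 𝔄 ι e L a hL (expFc ι e L) (expFsc ι e L) (expFf ι e L) (expFsf ι e L)
              (fun _ => LinearMap.id) (fun _ => LinearMap.id) (fun _ => LinearMap.id) (fun _ => LinearMap.id),
            Kunit := vWGCVecUnitRelKernel (d := d) 𝔄 ι e L a hL (expFc ι e L) (expFsc ι e L) (expFf ι e L) (expFsf ι e L)
              (fun _ => LinearMap.id) (fun _ => LinearMap.id) (fun _ => LinearMap.id) (fun _ => LinearMap.id),
            inΛ := fun _ _ => True, unitDist := fun j => (unitTorusGeoS L j.k j.Mn j.Msz).dist } :=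
  n15At_vectorPiece_vWordsExpC_of_rel (d := d) e a hd hL hL2 hc35 p (siteRelDatum_id (d := d) (ι := ι) (L := L) one_pos)
    (unitRelDatum_id (d := d) (ι := ι) (L := L) one_pos)

end Summit.QuantumFields.YangMills.BalabanUVNodes.N15.VectorPiece

end
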